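import Mathlib
import HarnessLib
import Summits.NavierStokesRegularity.NavierStokesRegularity.Theorems.ChiralWindowDoorDefs
import Summits.NavierStokesRegularity.NavierStokesRegularity.Theorems.ChiralWindowDoorChiralProfileRigidity
import Summits.NavierStokesRegularity.NavierStokesRegularity.Theorems.PoloidalWindowDoorPoloidalWindowRigiditySymmetryGerms
import Summits.NavierStokesRegularity.NavierStokesRegularity.Theorems.LocalSineTubeDoorProfileAlignedWindowRigidityAncient

/-!
# Door S21-C «CriticalFluxDoor» (nsreg-p1 ROUND-20, design-only) — the SPREAD stub: the local `Ḣ^{1/2}`-flux density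
# `Φ(v) = ⟪Λv, (v·∇)v⟫` of a door-class slice is real-analytic, so flux-freeness on a window spreads to the slice

Door S21-C of nsreg-p1's local Type-I door family (`HOME/ns-regularity-ideate-p1/ROUND-20.md`, texts `r20/Sketch21v3.lean`;
DESIGN-ONLY, route NOT born).  Its stub `stub_fluxSpread` asks: for a door-class profile (Type-I time rate, Type-I decay,
continuity on the open backward slab, unit-viscosity Oseen–Duhamel identity, divergence-free slices), if on every slice the
flux density `Φ(v s)(z) = ⟪Λ(v s)(z), D(v s)(z)(v s z)⟫` vanishes on a nonempty open set, then it vanishes identically on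
every slice.  With S20's analytic input now a tree theorem (`…ChiralWindowDoorChiralProfileRigidity.analyticOnNhd_fracLapHalf_of_class`,
from nsreg-typer g15's `analyticOnNhd_fracLaplacianHalf_of_typeI_ancient_mild`) this is the identity theorem:

* `analyticOnNhd_fluxDensity_of_class` — `z ↦ ⟪Λ(v s)(z), D(v s)(z)(v s z)⟫` is real-analytic on `ℝ³` for every slice
  `s < 0` of a door-class profile (`Λ(v s)`, `v s`, `D(v s)(v s)` analytic; the inner product is bilinear);
* `fluxSpread_of_class` — **S21-C's `stub_fluxSpread` with `fluxDensity`/`IsFluxFree` unfolded** (the sketch's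
  `fluxDensity u x := ⟪fracLapHalf u x, fderiv ℝ u x (u x)⟫` is not yet a tree definition; the statement below is its
  `δ`-unfolding, so the verbatim stub is a one-line corollary once S21-C's substrate lands).

Seat nsreg-p6 g12 (THEOREMS-ONLY door sequels, DIRECTOR-NS g8 #32 (2)/#36).  WHAT THIS IS NOT: not NS regularity
(Clay A); not S21-C's K1/K2 or its budget stubs F1–F3; no route is opened.
-/

noncomputable section

-- the summit and its single sub-problem share the name (CONVENTIONS §1), as in every Theorems file
set_option linter.dupNamespace false

namespace Summit.NavierStokesRegularity.NavierStokesRegularity.Theorems.CriticalFluxDoorFluxSpread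

open MeasureTheory Set Function Filter Topology Metric
open scoped RealInnerProductSpace
open Literature.Analysis Literature.Analysis.FluidPDE
open Summit.NavierStokesRegularity.NavierStokesRegularity.Theorems.ChiralWindowDoorDefs
open Summit.NavierStokesRegularity.NavierStokesRegularity.Theorems.ChiralWindowDoorChiralProfileRigidity
  (analyticOnNhd_fracLapHalf_of_class)
open Summit.NavierStokesRegularity.NavierStokesRegularity.Theorems.PoloidalWindowDoorPoloidalWindowRigiditySymmetryGerms
  (eq_of_eqOn_open analyticOnNhd_fderiv_apply)
open Summit.NavierStokesRegularity.NavierStokesRegularity.Theorems.LocalSineTubeDoorProfileAlignedWindowRigidityAncient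
  (analyticOnNhd_slice bdd_of_hasTypeITimeDecay)

variable {C D : ℝ} {v : ℝ → EuclideanSpace ℝ (Fin 3) → EuclideanSpace ℝ (Fin 3)}

/-- **The flux density of a door-class slice is real-analytic**: `z ↦ ⟪Λ(v s)(z), D(v s)(z)(v s z)⟫` is real-analytic on
`ℝ³` for every `s < 0`. -/
theorem analyticOnNhd_fluxDensity_of_class (hrate : HasTypeITimeDecay C v)
    (hcont : ContinuousOn (Function.uncurry v) (Set.Iio (0 : ℝ) ×ˢ Set.univ))
    (hmild : ∀ s t : ℝ, s < t → t < 0 → ∀ x,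
      v t x = UnboundedOperators.heatExtension (v s) (t - s) x - oseenDuhamel 1 s v v t x)
    (hdiv : ∀ t < 0, VectorCalculus.IsDivFree (v t)) {s : ℝ} (hs : s < 0) :
    AnalyticOnNhd ℝ (fun z => ⟪fracLapHalf (v s) z, fderiv ℝ (v s) z (v s z)⟫) univ := by
  have hΛ : AnalyticOnNhd ℝ (fracLapHalf (v s)) univ := analyticOnNhd_fracLapHalf_of_class hrate hcont hmild hdiv hs
  have hv : AnalyticOnNhd ℝ (v s) univ := analyticOnNhd_slice hcont (bdd_of_hasTypeITimeDecay hrate) hmild hs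
  have hDv : AnalyticOnNhd ℝ (fun z => fderiv ℝ (v s) z (v s z)) univ := analyticOnNhd_fderiv_apply hv hv
  have hB : AnalyticOnNhd ℝ (fun q : EuclideanSpace ℝ (Fin 3) × EuclideanSpace ℝ (Fin 3) =>
      (innerSL ℝ (E := EuclideanSpace ℝ (Fin 3))) q.1 q.2) univ := fun q _ =>
    (innerSL ℝ (E := EuclideanSpace ℝ (Fin 3))).analyticAt_bilinear q
  have h := hB.comp₂ hΛ hDv (fun x _ => mem_univ _)
  have e : (fun z => ⟪fracLapHalf (v s) z, fderiv ℝ (v s) z (v s z)⟫) =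
      fun z => (innerSL ℝ (E := EuclideanSpace ℝ (Fin 3))) (fracLapHalf (v s) z) (fderiv ℝ (v s) z (v s z)) := by
    funext z; rw [innerSL_apply_apply]
  rw [e]; exact h

/-- **S21-C's `stub_fluxSpread` (nsreg-p1 `r20/Sketch21v3.lean`), with `fluxDensity` / `IsFluxFree` unfolded, PROVED**:
for a door-class profile, flux-freeness `⟪Λ(v s), D(v s)(v s)⟫ = 0` on a nonempty open set of every slice spreads to every
point of every slice (identity theorem for the real-analytic flux density). -/
theorem fluxSpread_of_class : ∀ (C D : ℝ) (v : ℝ → EuclideanSpace ℝ (Fin 3) → EuclideanSpace ℝ (Fin 3)),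
    HasTypeITimeDecay C v → HasTypeIDecay D v →
    ContinuousOn (Function.uncurry v) (Set.Iio (0 : ℝ) ×ˢ Set.univ) →
    (∀ s t : ℝ, s < t → t < 0 → ∀ x,
        v t x = UnboundedOperators.heatExtension (v s) (t - s) x - oseenDuhamel 1 s v v t x) →
    (∀ t < 0, VectorCalculus.IsDivFree (v t)) →
    (∀ s < 0, ∃ U : Set (EuclideanSpace ℝ (Fin 3)), IsOpen U ∧ U.Nonempty ∧
      ∀ z ∈ U, ⟪fracLapHalf (v s) z, fderiv ℝ (v s) z (v s z)⟫ = 0) →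
    ∀ t < 0, ∀ x, ⟪fracLapHalf (v t) x, fderiv ℝ (v t) x (v t x)⟫ = 0 := by
  intro C D v hrate _hdecay hcont hmild hdiv hwin t ht x
  obtain ⟨U, hU, hne, hz⟩ := hwin t ht
  have han := analyticOnNhd_fluxDensity_of_class hrate hcont hmild hdiv ht
  have hzero : AnalyticOnNhd ℝ (fun _ : EuclideanSpace ℝ (Fin 3) => (0 : ℝ)) univ := fun z _ => analyticAt_const
  exact eq_of_eqOn_open han hzero hU hne hz x

end Summit.NavierStokesRegularity.NavierStokesRegularity.Theorems.CriticalFluxDoorFluxSpread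

end
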